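import Summits.QuantumAdvantage.AdviceFreeQNC0.LinearColumnsParity
import HarnessLib

/-!
# Cell qa-qnc0 (rung F-Q1, route RingFrame, crux α, line `tensor`): S1 = `LiftOneStrict` is FALSE
# (planner qa-qnc0-p2 gen 4, `S1-REFUTED.md` THEOREM A(5) + COROLLARY B2, ask N-2)

For the block family of `TensorBlockFamily.lean` (`L = n`, `L' = 2n`, `d = n − 2`, `w = 2^{n+1} − 1`)
EVERY lift `W` with linear columns and degree-`(n−2)` rows is far from `X`:

* `hw_xorM_ge : n·2^{2n−1} ≤ hw (X ⊕ W)` (THEOREM A(5)).  Proof: `X ⊕ W` has linear columns, so a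
  non-zero column has weight `≥ 2^{n−1}` (`card_filter_col_ge`), and column `v` is non-zero iff
  `v ∈ Z = ⋃_i supp (a_{e_i} + c_i)`, `c_i = W(e_i, ·)`; for every `r₀` the fibre
  `Z_{r₀} = {q : (q, r₀) ∈ Z}` has `≥ n` points (`card_fibre_ge`): otherwise (finite-dimensional
  linear algebra over `𝔽₂`, `exists_parity_vanishing`) a non-trivial parity `⟨1_J, ·⟩` vanishes on
  `Z_{r₀}`; the test function `h(q, r) = ⟨1_J, q⟩·[r = r₀]` has degree `≤ n + 1 = L' − d − 1`, so
  `#(supp c_i ∩ supp h)` is even (`even_card_of_hasDeg`: a polynomial of degree `< m` on `{0,1}^m`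
  has even weight), `supp (a_{e_i} + c_i) ∩ supp h = ∅`, hence `#(a_{e_i} ∩ supp h)` is even — but
  it is `{(e_i, r₀)}` for `i ∈ J`.
* `not_liftOneStrict : ¬ LiftOneStrict` (N-2): S1 would give `hw (X ⊕ W) ≤ K·w·2^L < K·2^{2n+1}`.

With `UnionBoundRefutation.lean`: UB, S1 and R of qn-p2's ROUND-2/3 are all refuted in the kernel; the
log factor of R1 = `LiftOneLog` is necessary (qn-p2 COROLLARY C; S1' = `LiftOneStrictLog` stays OPEN).
WHAT THIS IS NOT: nothing on S1'/R1, `TRPlus`, α or the separation.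
-/

namespace Summit.QuantumAdvantage.AdviceFreeQNC0

namespace TensorBlock

open Finset
open Literature.Computability.MetaComplexity Literature.Computability.MetaComplexity.Smolensky

variable {n : ℕ}

/-! ### THEOREM A(5): every lift is far -/

/-- The test function `h(q, r) = ⟨1_J, q⟩·[r = r₀]` has degree `≤ n + 1`. -/
theorem hasDeg_test (J : Finset (Fin n)) (r₀ : Fin n → Bool) :
    HasDeg (fun v : Fin (n + n) → Bool => CubeChar.subsetPar J (qp v) && decide (rp v = r₀)) (1 + n) := by
  classical
  have h1 : HasDeg (fun v : Fin (n + n) → Bool => CubeChar.subsetPar J (qp v)) 1 := by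
    unfold CubeChar.subsetPar qp
    exact hasDeg_parity J (fun j (v : Fin (n + n) → Bool) => v (Fin.castAdd n j))
      fun j _ => hasDeg_coord _
  have h2 : HasDeg (fun v : Fin (n + n) → Bool => decide (rp v = r₀)) n := by
    have e : (fun v : Fin (n + n) → Bool => decide (rp v = r₀)) =
        fun v => decide (∀ j ∈ (univ : Finset (Fin n)), decide (v (Fin.natAdd n j) = r₀ j) = true) := by
      funext v
      apply decide_eq_decide.2
      simp only [Finset.mem_univ, forall_const, decide_eq_true_eq]
      exact funext_iff
    rw [e]
    have h := hasDeg_forall (univ : Finset (Fin n))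
      (fun j (v : Fin (n + n) → Bool) => decide (v (Fin.natAdd n j) = r₀ j)) fun j _ => by
        cases r₀ j
        · have : (fun v : Fin (n + n) → Bool => decide (v (Fin.natAdd n j) = false)) =
              fun v => !v (Fin.natAdd n j) := by funext v; cases v (Fin.natAdd n j) <;> rfl
          rw [this]; exact hasDeg_not (hasDeg_coord _)
        · have : (fun v : Fin (n + n) → Bool => decide (v (Fin.natAdd n j) = true)) =
              fun v => v (Fin.natAdd n j) := by funext v; cases v (Fin.natAdd n j) <;> rfl
          rw [this]; exact hasDeg_coord _
    rw [Finset.card_univ, Fintype.card_fin] at h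
    convert h using 3
  exact hasDeg_and h1 h2

/-- **Every fibre of `Z` spans**: for a lift `W` (linear columns, degree-`(n−2)` rows) and every `r₀`,
at least `n` points `q` have `(q, r₀) ∈ Z = ⋃_i supp (X ⊕ W)(e_i, ·)`. -/
theorem card_fibre_ge (hn : 2 ≤ n) {W : (Fin n → Bool) → (Fin (n + n) → Bool) → Bool}
    (hWd : RowsDeg (n - 2) W) (r₀ : Fin n → Bool) :
    n ≤ ((univ : Finset (Fin n → Bool)).filter fun q =>
      ∃ i, xorM Xf W (basisRow i) (Fin.append q r₀) = true).card := by
  classical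
  by_contra hlt
  push Not at hlt
  obtain ⟨J, hJ, hvan⟩ := exists_parity_vanishing _ hlt
  obtain ⟨i, hi⟩ := hJ
  -- the test function
  set h : (Fin (n + n) → Bool) → Bool := fun v => CubeChar.subsetPar J (qp v) && decide (rp v = r₀) with hh
  -- (1) `#(supp c_i ∩ supp h)` is even
  have hev : Even ((univ : Finset (Fin (n + n) → Bool)).filter
      fun v => (W (basisRow i) v && h v) = true).card := by
    refine even_card_of_hasDeg (by omega) ?_
    have := hasDeg_and (hWd (basisRow i)) (hasDeg_test J r₀)
    exact hasDeg_of_le this (by omega)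
  -- (2) `supp (a_{e_i} + c_i) ∩ supp h = ∅`
  have hzero : ((univ : Finset (Fin (n + n) → Bool)).filter
      fun v => (xorM Xf W (basisRow i) v && h v) = true) = ∅ := by
    rw [Finset.filter_eq_empty_iff]
    intro v _ hv
    rw [Bool.and_eq_true, hh, Bool.and_eq_true, decide_eq_true_eq] at hv
    obtain ⟨hg, hpar, hr⟩ := hv
    have hq : qp v ∈ (univ : Finset (Fin n → Bool)).filter fun q =>
        ∃ i, xorM Xf W (basisRow i) (Fin.append q r₀) = true := by
      refine Finset.mem_filter.2 ⟨Finset.mem_univ _, i, ?_⟩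
      rw [← hr, append_qp_rp]; exact hg
    have := hvan _ hq
    rw [this] at hpar; exact Bool.false_ne_true hpar
  -- (3) `supp a_{e_i} ∩ supp h = {(e_i, r₀)}`
  have hone : ((univ : Finset (Fin (n + n) → Bool)).filter
      fun v => (ldr (basisRow i) v && h v) = true) = {Fin.append (basisRow i) r₀} := by
    ext v
    rw [Finset.mem_filter, Finset.mem_singleton, Bool.and_eq_true, hh, Bool.and_eq_true,
      decide_eq_true_eq]
    constructor
    · rintro ⟨-, ha, hpar, hr⟩
      have hq0 : qp v ≠ (fun _ => false) := fun h0 => by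
        rw [h0, CubeChar.subsetPar_zero] at hpar; exact Bool.false_ne_true hpar
      rw [ldr_of_qp_ne_zero hq0, decide_eq_true_eq] at ha
      rw [← ha, ← hr, append_qp_rp]
    · intro hv
      subst hv
      refine ⟨Finset.mem_univ _, ?_, ?_, rp_append _ _⟩
      · rw [ldr_of_qp_ne_zero (by rw [qp_append]; exact basisRow_ne_zero i), qp_append]; simp
      · have hJi : CubeChar.subsetPar J (basisRow i) = true := by
          unfold CubeChar.subsetPar
          have e : (J.filter fun j => basisRow i j = true) = {i} := by
            ext j
            simp only [Finset.mem_filter, basisRow, decide_eq_true_eq, Finset.mem_singleton]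
            exact ⟨fun h => h.2, fun h => ⟨h ▸ hi, h⟩⟩
          rw [e, Finset.card_singleton]; decide
        rw [qp_append]; exact hJi
  -- (4) parity: `[a ∧ h] = [(a + c) ∧ h] + [c ∧ h]` pointwise in `𝔽₂`
  have hpar : ((((univ : Finset (Fin (n + n) → Bool)).filter
      fun v => (ldr (basisRow i) v && h v) = true).card : ℕ) : ZMod 2) =
      ((((univ : Finset (Fin (n + n) → Bool)).filter
        fun v => (xorM Xf W (basisRow i) v && h v) = true).card : ℕ) : ZMod 2) +
      ((((univ : Finset (Fin (n + n) → Bool)).filter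
        fun v => (W (basisRow i) v && h v) = true).card : ℕ) : ZMod 2) := by
    rw [Finset.card_filter, Finset.card_filter, Finset.card_filter, Nat.cast_sum, Nat.cast_sum,
      Nat.cast_sum, ← Finset.sum_add_distrib]
    refine Finset.sum_congr rfl fun v _ => ?_
    have hX : Xf (basisRow i) v = ldr (basisRow i) v := by
      have e : basisRow i = ind {i} := by funext j; simp [basisRow, ind]
      rw [show Xf (basisRow i) v = Xf (ind {i}) v by rw [e], Xf_ind, CubeChar.subsetPar_singleton]
    unfold xorM
    rw [hX]
    generalize ldr (basisRow i) v = a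
    generalize W (basisRow i) v = c
    generalize h v = b
    cases a <;> cases c <;> cases b <;> decide
  rw [hzero, hone, Finset.card_empty, Finset.card_singleton] at hpar
  obtain ⟨t, ht⟩ := hev
  rw [ht] at hpar
  push_cast at hpar
  rw [CharTwo.add_self_eq_zero, add_zero] at hpar
  exact one_ne_zero hpar

/-- The rows `(q, r₀)` of `Z` are counted fibre by fibre. -/
theorem card_filter_rblock (r₀ : Fin n → Bool) (P : (Fin (n + n) → Bool) → Prop) [DecidablePred P] :
    ((univ : Finset (Fin (n + n) → Bool)).filter fun v => rp v = r₀ ∧ P v).card =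
      ((univ : Finset (Fin n → Bool)).filter fun q => P (Fin.append q r₀)).card := by
  symm
  refine Finset.card_bij (fun q _ => Fin.append q r₀) ?_ ?_ ?_
  · intro q hq
    rw [Finset.mem_filter] at hq ⊢
    exact ⟨Finset.mem_univ _, rp_append q r₀, hq.2⟩
  · intro q₁ _ q₂ _ h
    have := congrArg qp h
    rwa [qp_append, qp_append] at this
  · intro v hv
    rw [Finset.mem_filter] at hv
    refine ⟨qp v, Finset.mem_filter.2 ⟨Finset.mem_univ _, ?_⟩, ?_⟩
    · rw [← hv.2.1, append_qp_rp]; exact hv.2.2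
    · rw [← hv.2.1]; exact append_qp_rp v

/-- **THEOREM A(5): every lift is far** — `n·2^{2n−1} ≤ hw (X ⊕ W)` for every `W` with linear columns
and degree-`(n − 2)` rows. -/
theorem hw_xorM_ge (hn : 2 ≤ n) {W : (Fin n → Bool) → (Fin (n + n) → Bool) → Bool} (hW : LinCols W)
    (hWd : RowsDeg (n - 2) W) : n * 2 ^ (n + n - 1) ≤ hw (xorM Xf W) := by
  classical
  have hM : LinCols (xorM Xf W) := by
    refine ⟨fun v => ?_, fun v => ?_⟩
    · exact hasDeg_xor (linCols_Xf.1 v) (hW.1 v)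
    · unfold xorM; rw [linCols_Xf.2 v, hW.2 v]; rfl
  set Z := (univ : Finset (Fin (n + n) → Bool)).filter fun v => ∃ i, xorM Xf W (basisRow i) v = true
    with hZ
  -- column count: `2·hw ≥ 2^n·#Z`
  have hcols : 2 ^ n * Z.card ≤ 2 * hw (xorM Xf W) := by
    rw [hw_eq_sum_cols, Finset.mul_sum, Finset.card_eq_sum_ones, Finset.mul_sum, hZ, Finset.sum_filter]
    refine Finset.sum_le_sum fun v _ => ?_
    split_ifs with hv
    · rw [mul_one, two_mul_card_filter_col hM v hv]
    · exact Nat.zero_le _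
  -- fibre count: `#Z ≥ 2^n·n`
  have hfib : 2 ^ n * n ≤ Z.card := by
    have e : Z.card = ∑ r₀ : Fin n → Bool, ((univ : Finset (Fin n → Bool)).filter fun q =>
        ∃ i, xorM Xf W (basisRow i) (Fin.append q r₀) = true).card := by
      rw [Finset.card_eq_sum_card_fiberwise (f := rp) (t := univ) fun v _ => Finset.mem_univ _]
      refine Finset.sum_congr rfl fun r₀ _ => ?_
      have h := card_filter_rblock r₀ (fun v => ∃ i, xorM Xf W (basisRow i) v = true)
      beta_reduce at h
      rw [← h, hZ, Finset.filter_filter]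
      exact congrArg Finset.card (Finset.filter_congr fun v _ => and_comm)
    rw [e]
    calc 2 ^ n * n = ∑ _r₀ : Fin n → Bool, n := by
          rw [Finset.sum_const, Finset.card_univ, Fintype.card_fun, Fintype.card_bool, Fintype.card_fin,
            smul_eq_mul]
      _ ≤ _ := Finset.sum_le_sum fun r₀ _ => card_fibre_ge hn hWd r₀
  have e2 : n * 2 ^ (n + n - 1) * 2 = 2 ^ n * (2 ^ n * n) := by
    have : n + n - 1 + 1 = n + n := by omega
    calc n * 2 ^ (n + n - 1) * 2 = n * (2 ^ (n + n - 1 + 1)) := by rw [pow_succ]; ring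
      _ = 2 ^ n * (2 ^ n * n) := by rw [this, pow_add]; ring
  have := Nat.mul_le_mul_left (2 ^ n) hfib
  omega

/-! ### N-2 -/

/-- **N-2: `LiftOneStrict` (S1 = CONJECTURE STRICT-U) is false.** -/
theorem not_liftOneStrict : ¬ LiftOneStrict := by
  rintro ⟨K, hK, h⟩
  obtain ⟨m, hm⟩ := exists_nat_gt (4 * K)
  set n := m + 2 with hn
  have hn2 : 2 ≤ n := by omega
  have hnK : 4 * K < n := hm.trans (by rw [hn]; push_cast; linarith)
  have hrad : 2 * (2 ^ (n + 1) - 1) < 2 ^ (n + n - (n - 2)) := by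
    have e : n + n - (n - 2) = (n + 1) + 1 := by omega
    rw [e, pow_succ 2 (n + 1)]
    have : 1 ≤ 2 ^ (n + 1) := Nat.one_le_two_pow
    omega
  obtain ⟨W, hW, hWd, hcost⟩ := h n (n + n) (n - 2) (2 ^ (n + 1) - 1) hrad Xf Yf linCols_Xf
    rowsDeg_Yf rowDist_le
  have hlow := hw_xorM_ge hn2 hW hWd
  have hlowR : (n : ℝ) * (2 : ℝ) ^ (n + n - 1) ≤ (hw (xorM Xf W) : ℝ) := by exact_mod_cast hlow
  push_cast [Nat.one_le_two_pow] at hcost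
  -- `n·2^{2n−1} ≤ K (2^{n+1} − 1) 2^n < K·2^{n+1}·2^n = 4K·2^{2n−1}`
  have e : (2 : ℝ) ^ (n + 1) * (2 : ℝ) ^ n = 4 * (2 : ℝ) ^ (n + n - 1) := by
    have : n + 1 + n = (n + n - 1) + 2 := by omega
    rw [← pow_add, this, pow_add]; norm_num; ring
  have h1 : K * ((2 : ℝ) ^ (n + 1) - 1) * (2 : ℝ) ^ n < K * (2 : ℝ) ^ (n + 1) * (2 : ℝ) ^ n := by
    have : (0 : ℝ) < (2 : ℝ) ^ n := by positivity
    nlinarith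
  have h2 : K * (2 : ℝ) ^ (n + 1) * (2 : ℝ) ^ n = 4 * K * (2 : ℝ) ^ (n + n - 1) := by
    rw [mul_assoc, e]; ring
  have h3 : 4 * K * (2 : ℝ) ^ (n + n - 1) < (n : ℝ) * (2 : ℝ) ^ (n + n - 1) :=
    mul_lt_mul_of_pos_right hnK (by positivity)
  linarith

end TensorBlock

end Summit.QuantumAdvantage.AdviceFreeQNC0
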